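import Mathlib
import HarnessLib

/-!
# Route `PrintCf2`, crux stmt-BirchSwinnertonDyer-20509 `RamifiedOffTYZOfFacts`, THEOREM A's step (R7) in the kernel (abstract form):
# a finite family stable under a finite group is a sum of orbits — product version
# (cell `bsd-print-cf2`, LEAD cruxlead-20509 g32, line `offtyz-v7`, lineage cycle 33; fact-free, Theses-free, `def`-free)

HONEST FRAMING (`--supports stmt-BirchSwinnertonDyer-20509`; theorems only).  BSD is not proved by any of this; no class is closed by this file;
item 23431 (C⁺) and crux 20509 stay OPEN.  This is step (R7) of THEOREM A's kernel road (memo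
`Cruxes/RamifiedOffTYZOfFacts/Lines/offtyz_v7_TheoremARoad.md` §3) as PURE COMBINATORICS of a finite group action; nothing arithmetic.

Setting: a finite group `N` acting on a type `X`; a finite family `y : ι → X` indexed by `Φ : Finset ι` which is `N`-STABLE AS A MULTISET — for every
`g ∈ N` there is a bijection `π` of `Φ` with `g • y t = y (π t)` (this is the shape of sentence (S3) of the Tian–Yuan–Zhang seven-block display: «every
automorphism trivial on `L_d(i)` permutes the points `z^t`, `t ∈ Φ`»); a weight `f : X → R` into a commutative monoid and a submonoid `S ≤ R`.  The orbit
of `x₀` is written as the finite set `Finset.univ.image (· • x₀)` (no `Fintype` instance on `MulAction.orbit` is assumed).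

* `card_filter_eq_smul_eq` — the multiplicity `#{t ∈ Φ : y t = x}` is `N`-invariant: `= #{t ∈ Φ : y t = g • x}`.
* `prod_filter_mem_orbit_eq_pow` — over the part of `Φ` lying in ONE orbit `O = N • x₀` the product is `(∏_{x ∈ O} f x)^m`, `m` the common multiplicity.
* ★ `prod_mem_of_orbitProd_mem` — **if every orbit product `∏_{x ∈ N•(y t)} f x` (`t ∈ Φ`) lies in `S`, then `∏_{t∈Φ} f (y t) ∈ S`.**  (Strong induction
  on `#Φ`, peeling one orbit at a time.)  No hypothesis on `#Φ`, none on the multiplicities.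

Use (THEOREM A, (R7)): `N = Gal(M/ι L_n(i))` acting on `A(M)`, `y t = t • z`, `f = x`-coordinate, `S` = the squares of `ι L_n(i)`; the orbit products are
Galois-conjugates of the field norm `N_{k₀(z)/k₀}(x(z))`, a square by the half-norm transfer (`PrintCf2RamifiedOffTYZHalfNormTransfer.lean`), so the first
norm `N₁ = ∏_{t∈Φ} x(t•z)` is a square — for EVERY realisation `Φ`, whatever its orbit multiplicities.  PROOFS ONLY.

References: orbit decomposition of a finite `G`-set [folklore]; [cite: TianYuanZhang2017, §3.1 (p0011 L53–L58: Z(n) = Σ_{t∈Φ₀} z^t, Φ₀ a set of representatives of 2Cl_n)].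
-/

noncomputable section

open scoped Classical

namespace Summit.BirchSwinnertonDyer.PrintCf2.OrbitStableProduct

open Finset MulAction

variable {N X ι R : Type*} [Group N] [MulAction N X] [CommMonoid R]

/-! ## §1 The orbit as a finite set; multiplicities are constant along orbits -/

/-- Membership in the finite orbit `univ.image (· • x₀)` is membership in `MulAction.orbit N x₀`. [folklore] -/
theorem mem_image_smul_iff [Fintype N] {x₀ x : X} :
    x ∈ (Finset.univ : Finset N).image (fun g => g • x₀) ↔ x ∈ orbit N x₀ := by
  rw [Finset.mem_image, MulAction.mem_orbit_iff]
  constructor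
  · rintro ⟨g, -, hg⟩; exact ⟨g, hg⟩
  · rintro ⟨g, hg⟩; exact ⟨g, Finset.mem_univ _, hg⟩

/-- The finite orbit is `N`-stable: `g • x ∈ N • x₀ ↔ x ∈ N • x₀`. [folklore] -/
theorem smul_mem_image_smul_iff [Fintype N] {x₀ x : X} (g : N) :
    g • x ∈ (Finset.univ : Finset N).image (fun g => g • x₀) ↔ x ∈ (Finset.univ : Finset N).image (fun g => g • x₀) := by
  rw [mem_image_smul_iff, mem_image_smul_iff, MulAction.mem_orbit_iff, MulAction.mem_orbit_iff]
  constructor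
  · rintro ⟨h, hh⟩
    refine ⟨g⁻¹ * h, ?_⟩
    rw [mul_smul, hh, inv_smul_smul]
  · rintro ⟨h, hh⟩
    exact ⟨g * h, by rw [mul_smul, hh]⟩

/-- **The multiplicity of a value in an `N`-stable family is `N`-invariant**: if `g ∈ N` permutes the family (`g • y t = y (π t)` for a bijection `π`
of `Φ`), then `#{t ∈ Φ : y t = x} = #{t ∈ Φ : y t = g • x}`. [folklore] -/
theorem card_filter_eq_smul_eq {Φ : Finset ι} {y : ι → X} {g : N}
    (hπ : ∃ π : Φ → Φ, Function.Bijective π ∧ ∀ t : Φ, g • y t = y (π t)) (x : X) :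
    (Φ.filter fun t => y t = x).card = (Φ.filter fun t => y t = g • x).card := by
  obtain ⟨π, hbij, hπ⟩ := hπ
  let e := Equiv.ofBijective π hbij
  -- `π` restricts to a bijection between the two fibres (as subtypes of `Φ`)
  have key : ∀ t : Φ, y t = x ↔ y (e t) = g • x := by
    intro t
    change y t = x ↔ y (π t) = g • x
    rw [← hπ t]
    exact ⟨fun h => by rw [h], fun h => smul_left_cancel g h⟩
  -- a bijection between the two fibres, through `e`
  refine Finset.card_bij (fun a ha => ((e ⟨a, (Finset.mem_filter.mp ha).1⟩ : Φ) : ι)) (fun a ha => ?_)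
    (fun a₁ ha₁ a₂ ha₂ h => ?_) (fun b hb => ?_)
  · rw [Finset.mem_filter] at ha ⊢
    exact ⟨(e ⟨a, ha.1⟩).2, (key ⟨a, ha.1⟩).mp ha.2⟩
  · have h' : e ⟨a₁, (Finset.mem_filter.mp ha₁).1⟩ = e ⟨a₂, (Finset.mem_filter.mp ha₂).1⟩ := Subtype.ext h
    exact congrArg (fun s : Φ => (s : ι)) (e.injective h')
  · rw [Finset.mem_filter] at hb
    refine ⟨((e.symm ⟨b, hb.1⟩ : Φ) : ι), ?_, ?_⟩
    · rw [Finset.mem_filter]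
      refine ⟨(e.symm ⟨b, hb.1⟩).2, (key (e.symm ⟨b, hb.1⟩)).mpr ?_⟩
      rw [e.apply_symm_apply]; exact hb.2
    · have : (⟨((e.symm ⟨b, hb.1⟩ : Φ) : ι), (e.symm ⟨b, hb.1⟩).2⟩ : Φ) = e.symm ⟨b, hb.1⟩ := Subtype.ext rfl
      rw [this, e.apply_symm_apply]

/-- Along an orbit the multiplicity is constant: for `x ∈ N • x₀`, `#{t : y t = x} = #{t : y t = x₀}`. [folklore] -/
theorem card_filter_eq_const_on_orbit [Fintype N] {Φ : Finset ι} {y : ι → X}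
    (hΦ : ∀ g : N, ∃ π : Φ → Φ, Function.Bijective π ∧ ∀ t : Φ, g • y t = y (π t)) {x₀ x : X}
    (hx : x ∈ (Finset.univ : Finset N).image (fun g => g • x₀)) :
    (Φ.filter fun t => y t = x).card = (Φ.filter fun t => y t = x₀).card := by
  obtain ⟨g, -, rfl⟩ := Finset.mem_image.mp hx
  exact (card_filter_eq_smul_eq (hΦ g) x₀).symm

/-! ## §2 The product over the part of the family inside one orbit -/

/-- Over the indices whose value lies in the orbit `O = N • x₀`, the product of `f ∘ y` is `(∏_{x ∈ O} f x)^m` with `m = #{t : y t = x₀}`. [folklore] -/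
theorem prod_filter_mem_orbit_eq_pow [Fintype N] {Φ : Finset ι} {y : ι → X}
    (hΦ : ∀ g : N, ∃ π : Φ → Φ, Function.Bijective π ∧ ∀ t : Φ, g • y t = y (π t)) (f : X → R) (x₀ : X) :
    ∏ t ∈ Φ.filter (fun t => y t ∈ (Finset.univ : Finset N).image (fun g => g • x₀)), f (y t) =
      (∏ x ∈ (Finset.univ : Finset N).image (fun g => g • x₀), f x) ^ (Φ.filter fun t => y t = x₀).card := by
  set O := (Finset.univ : Finset N).image (fun g => g • x₀) with hO
  have hmaps : ∀ t ∈ Φ.filter (fun t => y t ∈ O), y t ∈ O := fun t ht => (Finset.mem_filter.mp ht).2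
  rw [← Finset.prod_fiberwise_of_maps_to hmaps (fun t => f (y t)), ← Finset.prod_pow]
  refine Finset.prod_congr rfl fun x hx => ?_
  have hfib : ∀ t ∈ (Φ.filter (fun t => y t ∈ O)).filter (fun t => y t = x), f (y t) = f x := by
    intro t ht
    rw [(Finset.mem_filter.mp ht).2]
  rw [Finset.prod_congr rfl hfib, Finset.prod_const]
  congr 1
  have : (Φ.filter (fun t => y t ∈ O)).filter (fun t => y t = x) = Φ.filter fun t => y t = x := by
    ext t
    simp only [Finset.mem_filter]
    constructor
    · rintro ⟨⟨ht, -⟩, h⟩; exact ⟨ht, h⟩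
    · rintro ⟨ht, h⟩; exact ⟨⟨ht, h ▸ hx⟩, h⟩
  rw [this, card_filter_eq_const_on_orbit hΦ hx]

/-! ## §3 Peeling orbits: the family product lies in any submonoid containing the orbit products -/

/-- The sub-family of indices whose value lies OUTSIDE a given orbit is again `N`-stable. [folklore] -/
theorem stable_filter_not_mem_orbit [Fintype N] {Φ : Finset ι} {y : ι → X}
    (hΦ : ∀ g : N, ∃ π : Φ → Φ, Function.Bijective π ∧ ∀ t : Φ, g • y t = y (π t)) (x₀ : X) :
    ∀ g : N, ∃ π : (Φ.filter fun t => y t ∉ (Finset.univ : Finset N).image (fun g => g • x₀)) →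
        (Φ.filter fun t => y t ∉ (Finset.univ : Finset N).image (fun g => g • x₀)),
      Function.Bijective π ∧
        ∀ t : (Φ.filter fun t => y t ∉ (Finset.univ : Finset N).image (fun g => g • x₀)), g • y t = y (π t) := by
  set O := (Finset.univ : Finset N).image (fun g => g • x₀) with hO
  intro g
  obtain ⟨π, hbij, hπ⟩ := hΦ g
  -- `π` preserves «value outside the orbit» (the orbit is `N`-stable), so it restricts to the sub-family
  have hout : ∀ t : Φ, y t ∉ O → y (π t) ∉ O := by
    intro t ht hin
    apply ht
    rw [← hπ, hO, smul_mem_image_smul_iff] at hin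
    exact hin
  have hmem : ∀ t : (Φ.filter fun t => y t ∉ O), (t : ι) ∈ Φ ∧ y t ∉ O := fun t => Finset.mem_filter.mp t.2
  refine ⟨fun t => ⟨(π ⟨t, (hmem t).1⟩ : ι), Finset.mem_filter.mpr ⟨(π ⟨t, (hmem t).1⟩).2, hout ⟨t, (hmem t).1⟩ (hmem t).2⟩⟩,
    ?_, fun t => hπ ⟨t, (hmem t).1⟩⟩
  -- injective (from `π`), hence bijective on the finite type
  apply Finite.injective_iff_bijective.mp
  intro t₁ t₂ h
  have h' : (π ⟨t₁, (hmem t₁).1⟩ : ι) = (π ⟨t₂, (hmem t₂).1⟩ : ι) := congrArg (fun s : (Φ.filter fun t => y t ∉ O) => (s : ι)) h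
  have h'' : π ⟨t₁, (hmem t₁).1⟩ = π ⟨t₂, (hmem t₂).1⟩ := Subtype.ext h'
  have := hbij.1 h''
  exact Subtype.ext (congrArg (fun s : Φ => (s : ι)) this)

/-- ★ **If every orbit product lies in the submonoid `S`, so does the family product.**  For an `N`-stable finite family `y` on `Φ` and a weight
`f : X → R`: `(∀ t ∈ Φ, ∏_{x ∈ N • y t} f x ∈ S) → ∏_{t∈Φ} f (y t) ∈ S`. [folklore] -/
theorem prod_mem_of_orbitProd_mem [Fintype N] (S : Submonoid R) (f : X → R) :
    ∀ (Φ : Finset ι) (y : ι → X),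
      (∀ g : N, ∃ π : Φ → Φ, Function.Bijective π ∧ ∀ t : Φ, g • y t = y (π t)) →
      (∀ t ∈ Φ, (∏ x ∈ (Finset.univ : Finset N).image (fun g => g • y t), f x) ∈ S) →
      (∏ t ∈ Φ, f (y t)) ∈ S := by
  intro Φ
  induction' hcard : Φ.card using Nat.strong_induction_on with k ih generalizing Φ
  intro y hΦ horb
  rcases Φ.eq_empty_or_nonempty with hΦe | ⟨t₀, ht₀⟩
  · rw [hΦe, Finset.prod_empty]; exact S.one_mem
  · -- split `Φ` along the orbit of `y t₀`
    set O := (Finset.univ : Finset N).image (fun g => g • y t₀) with hO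
    rw [← Finset.prod_filter_mul_prod_filter_not Φ (fun t => y t ∈ O) (fun t => f (y t))]
    refine S.mul_mem ?_ ?_
    · -- the orbit part: a power of the orbit product
      rw [prod_filter_mem_orbit_eq_pow hΦ f (y t₀)]
      exact pow_mem (horb t₀ ht₀) _
    · -- the rest: strictly smaller, still stable
      have hlt : (Φ.filter fun t => y t ∉ O).card < k := by
        rw [← hcard]
        apply Finset.card_lt_card
        refine ⟨Finset.filter_subset _ _, fun hsub => ?_⟩
        have := (Finset.mem_filter.mp (hsub ht₀)).2
        apply this
        rw [hO, Finset.mem_image]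
        exact ⟨1, Finset.mem_univ _, one_smul _ _⟩
      exact ih _ hlt (Φ.filter fun t => y t ∉ O) rfl y (stable_filter_not_mem_orbit hΦ (y t₀))
        (fun t ht => horb t (Finset.mem_filter.mp ht).1)

end Summit.BirchSwinnertonDyer.PrintCf2.OrbitStableProduct

end
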